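import Summits.Parity.BatemanHorn.Theorems.SelbergDelangeRigidityLSDRealSegmentTailsTwoClass
import Summits.Parity.BatemanHorn.Theorems.SelbergDelangeRigidityLSDRealSegmentTailsPeeledAux
import HarnessLib

/-!
# Route `SelbergDelangeRigidity`, crux `LSDRealSegment` (stmt-Parity-9770), line
# `product-anatomy-subcritical`: ingredients of the restoration engine of `stub_tailsTwo` (Nair–Tenenbaum side)

The engine of the small-prime restoration applies Nair–Tenenbaum's Theorem 1
(`Literature.NumberTheory.Sieve.NairTenenbaum1998_theorem1`, a NAMED FACT) to the rescaled system `Q` of every class of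
every dense slice (`tailsTwo_class_system`).  This file isolates the ingredients: (1) UNIFORM constants — the
constants of Theorem 1 depend on the discriminant `D`, and along the slicing `|D| ≤ D₀`, so they may be maximised over
`D ∈ [−D₀, D₀]` (`tailsTwo_nt_uniform`, registered helper); (2) the sieve product of a rescaled system,
`∏_{p ≤ N} (1 − ρ_Q(p)/p) ≤ K/(log N)^k` (`ρ_Q(p) = 0` for `p ≤ P`, `= ρ_f(p)` beyond; Mertens along `f`); (3) the
harmonic factor `Σ F ∏ ρ_{Qⱼ}/nⱼ ≤ ∏ⱼ Σ_m Fⱼ(m) ρ_{fⱼ}(m)/m` (`ρ_{Qⱼ} ≤ ρ_{fⱼ}`); (4) the values along a class,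
`Fᵢ(fᵢ(n)) = Fᵢ(Qᵢ(t))` for weights depending on `P`-rough parts; (5) the two admissible intervals in `t`.
-/

open Filter Finset Polynomial
open scoped BigOperators Topology Classical

namespace Summit.Parity.BatemanHorn.Cruxes.LSDRealSegment.ProductAnatomySubcritical

open Literature.NumberTheory.Sieve
open ArithmeticFunction (cardFactors)
noncomputable section

variable {k : ℕ}

/-! ### (1) Uniform constants in Nair–Tenenbaum over bounded discriminants -/

/-- **tailsTwo_nt_uniform** (registered helper of `stub_tailsTwo`, line `product-anatomy-subcritical`; CONDITIONAL on the
named fact `NairTenenbaum1998_theorem1`): Nair–Tenenbaum's Theorem 1 with constants `c₀, C ≥ 0` uniform over all systems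
whose product has discriminant `|D| ≤ D₀` (maximise the constants over the finitely many `D`). [folklore] -/
theorem tailsTwo_nt_uniform : NairTenenbaum1998_theorem1 →
    ∀ (k g D₀ : ℕ) (A B α δ ε : ℝ), 1 ≤ k → 1 ≤ A → 1 ≤ B → 0 < α → α < 1 → 0 < δ → δ < 1 →
    0 < ε → ε ≤ α * δ / (12 * (g : ℝ) ^ 2) →
    ∃ c₀ C : ℝ, 0 ≤ c₀ ∧ 0 ≤ C ∧ ∀ Q : Fin k → ℤ[X], (∀ j, Irreducible (Q j)) →
      (∀ i j, i ≠ j → IsCoprime ((Q i).map (Int.castRingHom ℚ)) ((Q j).map (Int.castRingHom ℚ))) →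
      HasNoFixedPrimeDivisor Q → (∏ j, Q j).natDegree = g → |(∏ j, Q j).discr| ≤ D₀ →
      ∀ F : (Fin k → ℕ) → ℝ, IsClassMk k A B ε F →
        ∀ x y : ℝ, c₀ * (polyHeight (∏ j, Q j) : ℝ) ^ δ ≤ x → x ^ α < y → y ≤ x →
          ∑ n ∈ (Finset.Ioc ⌊x⌋₊ ⌊x + y⌋₊).filter (fun n : ℕ => (∏ j, Q j).eval (n : ℤ) ≠ 0),
              F (fun j => ((Q j).eval (n : ℤ)).natAbs) ≤
            C * y * (∏ p ∈ (Finset.Icc 1 ⌊x⌋₊).filter Nat.Prime, (1 - (polyRootCountMod Q p : ℝ) / p)) *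
              ∑ n ∈ (Fintype.piFinset fun _ : Fin k => Finset.Icc 1 ⌊x⌋₊).filter (fun n => ∏ j, n j ≤ ⌊x⌋₊),
                F n * ∏ j, ((polyRootCountMod ![Q j] (n j) : ℝ) / (n j)) := by
  intro hNT k g D₀ A B α δ ε hk hA hB hα hα1 hδ hδ1 hε hεg
  choose c₀ C hC using fun D : ℤ => hNT k g D A B α δ ε hk hA hB hα hα1 hδ hδ1 hε hεg
  set S : Finset ℤ := Finset.Icc (-(D₀ : ℤ)) D₀ with hS
  refine ⟨∑ D ∈ S, max (c₀ D) 0, ∑ D ∈ S, max (C D) 0, Finset.sum_nonneg fun D _ => le_max_right _ _,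
    Finset.sum_nonneg fun D _ => le_max_right _ _, ?_⟩
  intro Q hirr hcop hfix hdeg hdisc F hF x y hx hxy hyx
  set D := (∏ j, Q j).discr with hD
  have hDS : D ∈ S := by
    rw [hS, Finset.mem_Icc]
    exact abs_le.mp hdisc
  have hc₀ : c₀ D ≤ ∑ D ∈ S, max (c₀ D) 0 :=
    (le_max_left _ _).trans (Finset.single_le_sum (f := fun D => max (c₀ D) 0) (fun D _ => le_max_right _ _) hDS)
  have hCle : C D ≤ ∑ D ∈ S, max (C D) 0 :=
    (le_max_left _ _).trans (Finset.single_le_sum (f := fun D => max (C D) 0) (fun D _ => le_max_right _ _) hDS)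
  have hH0 : (0 : ℝ) ≤ (polyHeight (∏ j, Q j) : ℝ) ^ δ := Real.rpow_nonneg (Nat.cast_nonneg _) _
  have hx' : c₀ D * (polyHeight (∏ j, Q j) : ℝ) ^ δ ≤ x := (mul_le_mul_of_nonneg_right hc₀ hH0).trans hx
  have h := hC D Q hirr hcop hfix hdeg rfl F hF x y hx' hxy hyx
  refine h.trans ?_
  have hx0 : 0 ≤ x := le_trans (mul_nonneg (Finset.sum_nonneg fun D _ => le_max_right _ _) hH0) hx
  have hy0 : 0 ≤ y := le_trans (Real.rpow_nonneg hx0 α) hxy.le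
  have hP0 : 0 ≤ ∏ p ∈ (Finset.Icc 1 ⌊x⌋₊).filter Nat.Prime, (1 - (polyRootCountMod Q p : ℝ) / p) :=
    Finset.prod_nonneg fun p hp => by
      have hp' := (Finset.mem_filter.mp hp).2
      have : (polyRootCountMod Q p : ℝ) ≤ p := by exact_mod_cast polyRootCountMod_le Q p
      have hp0 : (0 : ℝ) < p := by exact_mod_cast hp'.pos
      rw [sub_nonneg, div_le_one hp0]
      exact this
  have hS0 : 0 ≤ ∑ n ∈ (Fintype.piFinset fun _ : Fin k => Finset.Icc 1 ⌊x⌋₊).filter (fun n => ∏ j, n j ≤ ⌊x⌋₊),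
      F n * ∏ j, ((polyRootCountMod ![Q j] (n j) : ℝ) / (n j)) :=
    Finset.sum_nonneg fun n _ => mul_nonneg (hF.1 n) (Finset.prod_nonneg fun j _ => by positivity)
  have : C D * y * (∏ p ∈ (Finset.Icc 1 ⌊x⌋₊).filter Nat.Prime, (1 - (polyRootCountMod Q p : ℝ) / p)) ≤
      (∑ D ∈ S, max (C D) 0) * y * (∏ p ∈ (Finset.Icc 1 ⌊x⌋₊).filter Nat.Prime, (1 - (polyRootCountMod Q p : ℝ) / p)) :=
    mul_le_mul_of_nonneg_right (mul_le_mul_of_nonneg_right hCle hy0) hP0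
  exact mul_le_mul_of_nonneg_right this hS0

/-! ### (2) The sieve product of a rescaled system -/

/-- **The sieve product along a rescaled system**: if `ρ_Q(p) = 0` for primes `p ≤ P` and `ρ_Q(p) = ρ_f(p)` for
`p > P` then `∏_{p ≤ N} (1 − ρ_Q(p)/p) ≤ K/(log N)^k` for `N ≥ 2`, with `K = K(f, P)` (Mertens along `f`, the finitely
many factors at `p ≤ P` restored). [folklore] -/
theorem prod_one_sub_rootCount_rescale_le {f : Fin k → ℤ[X]} (hf : IsBatemanHornSystem f) (P : ℕ) :
    ∃ K : ℝ, 0 < K ∧ ∀ Q : Fin k → ℤ[X], (∀ p : ℕ, p.Prime → p ≤ P → polyRootCountMod Q p = 0) →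
      (∀ p : ℕ, p.Prime → P < p → polyRootCountMod Q p = polyRootCountMod f p) →
      ∀ N : ℕ, 2 ≤ N → ∏ p ∈ (Finset.Icc 1 N).filter Nat.Prime, (1 - (polyRootCountMod Q p : ℝ) / p) ≤ K / Real.log N ^ k := by
  obtain ⟨M, hM0, hM⟩ := exists_prod_one_sub_rootCount_le hf
  set g : ℕ → ℝ := fun p => 1 - (polyRootCountMod f p : ℝ) / p with hg
  set πP : ℝ := ∏ p ∈ Nat.primesLE P, g p with hπP
  have hg01 : ∀ p : ℕ, p.Prime → 0 < g p ∧ g p ≤ 1 := by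
    intro p hp
    have hp0 : (0 : ℝ) < p := by exact_mod_cast hp.pos
    have hlt : (polyRootCountMod f p : ℝ) < p := by exact_mod_cast hf.hasNoFixedPrimeDivisor p hp
    refine ⟨by rw [hg, sub_pos, div_lt_one hp0]; exact hlt, ?_⟩
    rw [hg, sub_le_self_iff]
    positivity
  have hπP0 : 0 < πP := Finset.prod_pos fun p hp => (hg01 p (Nat.prime_of_mem_primesLE hp)).1
  refine ⟨(M + 1) / πP, by positivity, fun Q h0 h1 N hN => ?_⟩
  have hlogN : 0 < Real.log N := Real.log_pos (by exact_mod_cast hN)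
  rw [filter_prime_Icc_eq_primesLE]
  -- split the primes `≤ N` at `P`
  set A := (Nat.primesLE N).filter (fun p => p ≤ P) with hA
  set B := (Nat.primesLE N).filter (fun p => ¬ p ≤ P) with hB
  have hQA : ∀ p ∈ A, (1 - (polyRootCountMod Q p : ℝ) / p) = 1 := fun p hp => by
    rw [Finset.mem_filter] at hp
    rw [h0 p (Nat.prime_of_mem_primesLE hp.1) hp.2, Nat.cast_zero, zero_div, sub_zero]
  have hQB : ∀ p ∈ B, (1 - (polyRootCountMod Q p : ℝ) / p) = g p := fun p hp => by
    rw [Finset.mem_filter] at hp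
    rw [h1 p (Nat.prime_of_mem_primesLE hp.1) (not_le.mp hp.2)]
  have hsplitQ : ∏ p ∈ Nat.primesLE N, (1 - (polyRootCountMod Q p : ℝ) / p) = ∏ p ∈ B, g p := by
    rw [← Finset.prod_filter_mul_prod_filter_not (Nat.primesLE N) (fun p => p ≤ P), Finset.prod_congr rfl hQA,
      Finset.prod_const_one, one_mul]
    exact Finset.prod_congr rfl hQB
  have hsplitf : ∏ p ∈ Nat.primesLE N, g p = (∏ p ∈ A, g p) * ∏ p ∈ B, g p :=
    (Finset.prod_filter_mul_prod_filter_not _ _ _).symm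
  -- the small primes: `∏_A g ≥ πP`
  have hAsub : A ⊆ Nat.primesLE P := fun p hp => by
    rw [hA, Finset.mem_filter, Nat.mem_primesLE] at hp
    exact Nat.mem_primesLE.mpr ⟨hp.2, hp.1.2⟩
  have hAge : πP ≤ ∏ p ∈ A, g p :=
    Finset.prod_le_prod_of_subset_of_le_one hAsub (fun p hp => (hg01 p (Nat.prime_of_mem_primesLE hp)).1.le)
      fun p hp _ => (hg01 p (Nat.prime_of_mem_primesLE hp)).2
  have hA0 : 0 < ∏ p ∈ A, g p := lt_of_lt_of_le hπP0 hAge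
  have hB0 : 0 ≤ ∏ p ∈ B, g p := Finset.prod_nonneg fun p hp =>
    (hg01 p (Nat.prime_of_mem_primesLE (Finset.mem_filter.mp hp).1)).1.le
  rw [hsplitQ]
  have key : (∏ p ∈ A, g p) * ∏ p ∈ B, g p ≤ M / Real.log N ^ k := by rw [← hsplitf]; exact hM N hN
  rw [le_div_iff₀ (pow_pos hlogN k)]
  rw [le_div_iff₀ (pow_pos hlogN k)] at key
  have h2 : πP * ((∏ p ∈ B, g p) * Real.log N ^ k) ≤ M := by
    calc πP * ((∏ p ∈ B, g p) * Real.log N ^ k) ≤ (∏ p ∈ A, g p) * ((∏ p ∈ B, g p) * Real.log N ^ k) :=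
          mul_le_mul_of_nonneg_right hAge (by positivity)
      _ = (∏ p ∈ A, g p) * (∏ p ∈ B, g p) * Real.log N ^ k := by ring
      _ ≤ M := key
  rw [le_div_iff₀ hπP0]
  calc (∏ p ∈ B, g p) * Real.log N ^ k * πP = πP * ((∏ p ∈ B, g p) * Real.log N ^ k) := by ring
    _ ≤ M := h2
    _ ≤ M + 1 := by linarith

/-! ### (3) The harmonic factor -/

/-- **The harmonic factor**: for product weights and `ρ_{Qⱼ} ≤ ρ_{fⱼ}` termwise,
`Σ_{n, ∏ nⱼ ≤ N} (∏ Fⱼ(nⱼ)) ∏ ρ_{Qⱼ}(nⱼ)/nⱼ ≤ ∏ⱼ Σ_{m ≤ N'} Fⱼ(m) ρ_{fⱼ}(m)/m` (`N ≤ N'`). [folklore] -/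
theorem piFinset_sum_le_prod_sum {Q f : Fin k → ℤ[X]} (hρ : ∀ (j : Fin k) (m : ℕ), polyRootCountMod ![Q j] m ≤ polyRootCountMod ![f j] m)
    {F : Fin k → ℕ → ℝ} (hF0 : ∀ j m, 0 ≤ F j m) {N N' : ℕ} (hN : N ≤ N') :
    ∑ n ∈ (Fintype.piFinset fun _ : Fin k => Finset.Icc 1 N).filter (fun n => ∏ j, n j ≤ N),
        (∏ j, F j (n j)) * ∏ j, ((polyRootCountMod ![Q j] (n j) : ℝ) / (n j)) ≤
      ∏ j, ∑ m ∈ Finset.Icc 1 N', F j m * (polyRootCountMod ![f j] m : ℝ) / m := by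
  have hterm0 : ∀ n : Fin k → ℕ, 0 ≤ (∏ j, F j (n j)) * ∏ j, ((polyRootCountMod ![Q j] (n j) : ℝ) / (n j)) := fun n =>
    mul_nonneg (Finset.prod_nonneg fun j _ => hF0 j _) (Finset.prod_nonneg fun j _ => by positivity)
  calc _ ≤ ∑ n ∈ (Fintype.piFinset fun _ : Fin k => Finset.Icc 1 N),
          (∏ j, F j (n j)) * ∏ j, ((polyRootCountMod ![Q j] (n j) : ℝ) / (n j)) :=
        Finset.sum_le_sum_of_subset_of_nonneg (Finset.filter_subset _ _) fun n _ _ => hterm0 n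
    _ ≤ ∑ n ∈ (Fintype.piFinset fun _ : Fin k => Finset.Icc 1 N),
          ∏ j, (F j (n j) * (polyRootCountMod ![f j] (n j) : ℝ) / (n j)) := by
        refine Finset.sum_le_sum fun n _ => ?_
        rw [← Finset.prod_mul_distrib]
        refine Finset.prod_le_prod (fun j _ => mul_nonneg (hF0 j _) (by positivity)) fun j _ => ?_
        rw [mul_div_assoc]
        exact mul_le_mul_of_nonneg_left (div_le_div_of_nonneg_right (by exact_mod_cast hρ j (n j)) (Nat.cast_nonneg _))
          (hF0 j _)
    _ = ∏ j : Fin k, ∑ m ∈ Finset.Icc 1 N, F j m * (polyRootCountMod ![f j] m : ℝ) / m :=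
        (Finset.prod_univ_sum (fun _ : Fin k => Finset.Icc 1 N)
          (fun j m => F j m * (polyRootCountMod ![f j] m : ℝ) / m)).symm
    _ ≤ ∏ j, ∑ m ∈ Finset.Icc 1 N', F j m * (polyRootCountMod ![f j] m : ℝ) / m := by
        refine Finset.prod_le_prod (fun j _ => Finset.sum_nonneg fun m _ => ?_) fun j _ =>
          Finset.sum_le_sum_of_subset_of_nonneg (Finset.Icc_subset_Icc_right hN) fun m _ _ => ?_ <;>
        exact div_nonneg (mul_nonneg (hF0 j _) (Nat.cast_nonneg _)) (Nat.cast_nonneg _)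

/-! ### (4) The values along a class -/

/-- **Values along a class**: if `sᵢ Qᵢ(t) = fᵢ(n) ≥ 1` with `sᵢ` `P`-smooth, then `Qᵢ(t) ≥ 1`, `fᵢ(n) = sᵢ |Qᵢ(t)|`, and
every weight depending only on `P`-rough parts takes the same value at `fᵢ(n)` and at `Qᵢ(t)`. [folklore] -/
theorem weight_val_eq_of_class {f : Fin k → ℤ[X]} {i : Fin k} {n : ℕ} {s : ℕ} {q : ℤ} {P : ℕ}
    (hn : (1 : ℤ) ≤ (f i).eval (n : ℤ)) (hs : s ≠ 0) (hsP : ∀ p ∈ s.primeFactors, p ≤ P)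
    (hval : (s : ℤ) * q = (f i).eval (n : ℤ)) {F : ℕ → ℝ} (hF : ∀ m, F m = F (roughPart (P : ℝ) m)) :
    0 < q ∧ val f i n = s * q.natAbs ∧ F (val f i n) = F q.natAbs := by
  have hq0 : 0 < q := by
    by_contra h
    push Not at h
    have : (s : ℤ) * q ≤ 0 := mul_nonpos_of_nonneg_of_nonpos (by positivity) h
    omega
  have hv : val f i n = s * q.natAbs := by
    rw [val, max_eq_left (by omega : 1 ≤ ((f i).eval (n : ℤ)).toNat)]
    have : ((((f i).eval (n : ℤ)).toNat : ℕ) : ℤ) = ((s * q.natAbs : ℕ) : ℤ) := by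
      rw [Int.toNat_of_nonneg (by omega), Nat.cast_mul, Int.natAbs_of_nonneg hq0.le, hval]
    exact_mod_cast this
  refine ⟨hq0, hv, ?_⟩
  have hqn : q.natAbs ≠ 0 := by omega
  rw [hv, hF, roughPart_smooth_mul hs (fun p hp => by exact_mod_cast hsP p hp) hqn, ← hF]

/-! ### (5) The two admissible intervals -/

/-- For `ℓ ≥ 16` and `ℓ − 1 ≤ x ≤ ℓ`, the intervals `(x, x + ℓ/2]` and `(x + ℓ/2, x + ℓ]` are admissible in Nair–Tenenbaum
with `α = 1/4` (length `≤` start, length `>` start^{1/4}). [folklore] -/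
theorem nt_intervals_admissible {ℓ x : ℝ} (hℓ : 16 ≤ ℓ) (hx : ℓ - 1 ≤ x) (hx' : x ≤ ℓ) :
    ℓ / 2 ≤ x ∧ x ^ (1 / 4 : ℝ) < ℓ / 2 ∧ ℓ / 2 ≤ x + ℓ / 2 ∧ (x + ℓ / 2) ^ (1 / 4 : ℝ) < ℓ / 2 := by
  have hx0 : 0 ≤ x := by linarith
  have key : ∀ z : ℝ, 0 ≤ z → z ≤ 2 * ℓ → z ^ (1 / 4 : ℝ) < ℓ / 2 := by
    intro z hz0 hz
    have h4 : ((ℓ / 2) ^ 4) ^ (1 / 4 : ℝ) = ℓ / 2 := by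
      rw [show (1 / 4 : ℝ) = ((4 : ℕ) : ℝ)⁻¹ by norm_num]
      exact Real.pow_rpow_inv_natCast (by linarith) (by norm_num)
    rw [← h4]
    refine Real.rpow_lt_rpow hz0 ?_ (by norm_num)
    nlinarith [sq_nonneg ℓ, sq_nonneg (ℓ - 16)]
  exact ⟨by linarith, key x hx0 (by linarith), by linarith, key (x + ℓ / 2) (by linarith) (by linarith)⟩

/-- The `t`-interval of a class splits into the two admissible halves. [folklore] -/
theorem sum_Ioc_floor_split (a : ℝ) {ℓ : ℝ} (hℓ : 0 ≤ ℓ) (G : ℕ → ℝ) :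
    ∑ t ∈ Finset.Ioc ⌊a⌋₊ ⌊a + ℓ⌋₊, G t =
      ∑ t ∈ Finset.Ioc ⌊a⌋₊ ⌊a + ℓ / 2⌋₊, G t + ∑ t ∈ Finset.Ioc ⌊a + ℓ / 2⌋₊ ⌊a + ℓ / 2 + ℓ / 2⌋₊, G t := by
  rw [show a + ℓ / 2 + ℓ / 2 = a + ℓ by ring]
  exact (Finset.sum_Ioc_consecutive G (Nat.floor_mono (by linarith)) (Nat.floor_mono (by linarith))).symm

end

end Summit.Parity.BatemanHorn.Cruxes.LSDRealSegment.ProductAnatomySubcritical
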